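import Mathlib
import HarnessLib

/-!
# `HeteroclinicTriggerChain` — crux `TriggerChainFrontStep` (item stmt-NavierStokesRegularity-22785):
  the DELAY PHASE of the forced arc with ADDITIVE forcing (segment form)

Before ignition the hop of the trigger chain is governed, in the reduced variables `D = x − y`,
`u` = trigger, by `D′ = −2e·u² + f₁`, `u′ = e·D·u + f₂`. On the seeded truncation `f₂ = 0` and the
trigger equation is of exact rate form (`…TriggerChainFrontStepTruncWindows/TruncPassage`, sibling seat);
on the LATTICE the trigger row carries junk terms NOT proportional to `u` (`…TriggerRow`,
`…LatticeCapture`: `|f₂| ≤ φ₂`), so the delay phase needs the additive-forcing form proved here, with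
one-sided derivatives on the window (the regularity of `TaoCascade.PseudoFlowOn`):

* `heteroclinicTriggerChain_forcedDelayOn_carrier_window` — while `|u| ≤ h`:
  `D(0) − (2eh² + φ)t ≤ D(t) ≤ D(0) + φt`;
* `heteroclinicTriggerChain_forcedDelayOn_growth_upper` — if `|D| ≤ D₊` then
  `|u(t)| ≤ |u(0)|e^{eD₊t} + (φ₂/(eD₊))(e^{eD₊t} − 1)` (Grönwall);
* `heteroclinicTriggerChain_forcedDelayOn_growth_lower` — if `D ≥ D₋ > 0` and `u(0) > φ₂/(eD₋)` then
  `u(t) ≥ (u(0) − φ₂/(eD₋))e^{eD₋t} + φ₂/(eD₋)` (fencing with a strictly slower comparison solution and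
  `ε → 0`);
* `heteroclinicTriggerChain_forcedDelayOn_ignition` — hence the trigger reaches any level `h` by the time
  `(u(0) − φ₂/(eD₋))e^{eD₋T} ≥ h`: the `log(h/u₀)/e` delay law with forcing.

HONEST FRAMING: elementary real analysis of a planar ODE with bounded forcing on a segment; helper
lemmas for the crux (no stub credit); nothing here is a statement about the Navier–Stokes equations;
no summit, rung or crux is proved by this file.
-/

noncomputable section

set_option linter.dupNamespace false

open Real Set

namespace Summit.NavierStokesRegularity.NavierStokesRegularity.Theorems

/-- **Carrier window in the delay phase.** If on `[0,T]` (derivatives within the segment)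
`D′ = −2eu² + f₁` with `e ≥ 0`, `|f₁| ≤ φ` and `|u| ≤ h`, then
`D(0) − (2eh² + φ)·t ≤ D(t) ≤ D(0) + φ·t` for `t ∈ [0,T]`. [folklore] -/
theorem heteroclinicTriggerChain_forcedDelayOn_carrier_window {e φ h T : ℝ} {D u f₁ : ℝ → ℝ}
    (he : 0 ≤ e)
    (hD : ∀ t ∈ Icc 0 T, HasDerivWithinAt D (-(2 * e * u t ^ 2) + f₁ t) (Icc 0 T) t)
    (hf₁ : ∀ t ∈ Icc 0 T, |f₁ t| ≤ φ) (huh : ∀ t ∈ Icc 0 T, |u t| ≤ h) :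
    ∀ t ∈ Icc 0 T, D 0 - (2 * e * h ^ 2 + φ) * t ≤ D t ∧ D t ≤ D 0 + φ * t := by
  have hDc : ContinuousOn D (Icc 0 T) := fun s hs => (hD s hs).continuousWithinAt
  have hD' : ∀ s ∈ Ico 0 T, HasDerivWithinAt D (-(2 * e * u s ^ 2) + f₁ s) (Ici s) s := fun s hs =>
    (hD s (Ico_subset_Icc_self hs)).mono_of_mem_nhdsWithin (Icc_mem_nhdsGE_of_mem hs)
  intro t ht
  constructor
  · -- lower fence: -D ≤ -(D 0) + (2eh² + φ) t
    have hnegc : ContinuousOn (fun s => -D s) (Icc 0 T) := hDc.neg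
    have hneg' : ∀ s ∈ Ico 0 T, HasDerivWithinAt (fun s => -D s) (-(-(2 * e * u s ^ 2) + f₁ s))
        (Ici s) s := fun s hs => (hD' s hs).neg
    have h := image_le_of_deriv_right_le_deriv_boundary (f := fun s => -D s) (a := 0) (b := T)
      (B := fun s => -D 0 + (2 * e * h ^ 2 + φ) * s) (B' := fun _ => 2 * e * h ^ 2 + φ)
      hnegc hneg' (by simp) (by fun_prop)
      (fun s _ => by
        have h := ((hasDerivAt_id s).const_mul (2 * e * h ^ 2 + φ)).const_add (-D 0)
        simpa using h.hasDerivWithinAt)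
      (fun s hs => by
        have hs' := Ico_subset_Icc_self hs
        have hu2 : u s ^ 2 ≤ h ^ 2 := by
          have := huh s hs'; have := abs_nonneg (u s); nlinarith [sq_abs (u s)]
        have hf := (abs_le.1 (hf₁ s hs')).1
        nlinarith)
      ht
    linarith
  · have h := image_le_of_deriv_right_le_deriv_boundary (f := D) (a := 0) (b := T)
      (B := fun s => D 0 + φ * s) (B' := fun _ => φ) hDc hD' (by simp) (by fun_prop)
      (fun s _ => by
        have h := ((hasDerivAt_id s).const_mul φ).const_add (D 0)
        simpa using h.hasDerivWithinAt)
      (fun s hs => by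
        have hs' := Ico_subset_Icc_self hs
        have hf := (abs_le.1 (hf₁ s hs')).2
        nlinarith [sq_nonneg (u s)])
      ht
    simpa using h

/-- **Upper growth in the delay phase (Grönwall).** If on `[0,T]` (derivatives within the segment)
`u′ = eDu + f₂` with `e ≥ 0`, `|D| ≤ D₊`, `D₊ > 0` and `|f₂| ≤ φ₂`, then
`|u(t)| ≤ |u(0)|·e^{eD₊t} + (φ₂/(eD₊))·(e^{eD₊t} − 1)` for `t ∈ [0,T]`. [folklore] -/
theorem heteroclinicTriggerChain_forcedDelayOn_growth_upper {e φ₂ Dp T : ℝ} {D u f₂ : ℝ → ℝ}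
    (he : 0 < e) (hDp : 0 < Dp)
    (hu : ∀ t ∈ Icc 0 T, HasDerivWithinAt u (e * D t * u t + f₂ t) (Icc 0 T) t)
    (hf₂ : ∀ t ∈ Icc 0 T, |f₂ t| ≤ φ₂) (hDD : ∀ t ∈ Icc 0 T, |D t| ≤ Dp) :
    ∀ t ∈ Icc 0 T, |u t| ≤ |u 0| * Real.exp (e * Dp * t) + φ₂ / (e * Dp) * (Real.exp (e * Dp * t) - 1) := by
  have huc : ContinuousOn u (Icc 0 T) := fun s hs => (hu s hs).continuousWithinAt
  have hu' : ∀ s ∈ Ico 0 T, HasDerivWithinAt u (e * D s * u s + f₂ s) (Ici s) s := fun s hs =>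
    (hu s (Ico_subset_Icc_self hs)).mono_of_mem_nhdsWithin (Icc_mem_nhdsGE_of_mem hs)
  have hK : e * Dp ≠ 0 := (mul_pos he hDp).ne'
  intro t ht
  have hg := norm_le_gronwallBound_of_norm_deriv_right_le (f := u) (f' := fun s => e * D s * u s + f₂ s)
    (δ := |u 0|) (K := e * Dp) (ε := φ₂) (a := 0) (b := T) huc hu' (by simp)
    (fun s hs => by
      have hs' := Ico_subset_Icc_self hs
      rw [Real.norm_eq_abs, Real.norm_eq_abs]
      calc |e * D s * u s + f₂ s| ≤ |e * D s * u s| + |f₂ s| := abs_add_le _ _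
        _ ≤ e * Dp * |u s| + φ₂ := by
            rw [abs_mul, abs_mul, abs_of_pos he]
            have := mul_le_mul_of_nonneg_right (hDD s hs') (abs_nonneg (u s))
            nlinarith [hf₂ s hs', abs_nonneg (u s)]) t ht
  rw [Real.norm_eq_abs, sub_zero, gronwallBound_of_K_ne_0 hK] at hg
  simpa using hg

/-- **Lower growth in the delay phase (forced).** If on `[0,T]` (derivatives within the segment)
`u′ = eDu + f₂` with `e > 0`, `D ≥ D₋ > 0`, `|f₂| ≤ φ₂` and the trigger starts above the forcing floor,
`u(0) > φ₂/(eD₋)`, then `u(t) ≥ (u(0) − φ₂/(eD₋))·e^{eD₋t} + φ₂/(eD₋)` for `t ∈ [0,T]` (in particular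
`u` stays positive and grows at rate at least `eD₋` above the floor). [folklore] -/
theorem heteroclinicTriggerChain_forcedDelayOn_growth_lower {e φ₂ Dm T : ℝ} {D u f₂ : ℝ → ℝ}
    (he : 0 < e) (hDm : 0 < Dm)
    (hu : ∀ t ∈ Icc 0 T, HasDerivWithinAt u (e * D t * u t + f₂ t) (Icc 0 T) t)
    (hf₂ : ∀ t ∈ Icc 0 T, |f₂ t| ≤ φ₂) (hDD : ∀ t ∈ Icc 0 T, Dm ≤ D t)
    (hu0 : φ₂ / (e * Dm) < u 0) :
    ∀ t ∈ Icc 0 T, (u 0 - φ₂ / (e * Dm)) * Real.exp (e * Dm * t) + φ₂ / (e * Dm) ≤ u t := by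
  intro t ht
  rcases lt_or_ge T 0 with hT0 | hT0
  · exact absurd (ht.1.trans ht.2) (not_le.2 hT0)
  have hφ : 0 ≤ φ₂ := (abs_nonneg _).trans (hf₂ 0 ⟨le_rfl, hT0⟩)
  have hK : 0 < e * Dm := mul_pos he hDm
  have huc : ContinuousOn u (Icc 0 T) := fun s hs => (hu s hs).continuousWithinAt
  have hu' : ∀ s ∈ Ico 0 T, HasDerivWithinAt u (e * D s * u s + f₂ s) (Ici s) s := fun s hs =>
    (hu s (Ico_subset_Icc_self hs)).mono_of_mem_nhdsWithin (Icc_mem_nhdsGE_of_mem hs)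
  -- margin above the floor
  have hgap : 0 < e * Dm * u 0 - φ₂ := by
    have := (div_lt_iff₀ hK).1 hu0; linarith
  -- comparison solutions with forcing φ₂ + ε
  have hmain : ∀ ε : ℝ, 0 < ε → ε < e * Dm * u 0 - φ₂ →
      (u 0 - (φ₂ + ε) / (e * Dm)) * Real.exp (e * Dm * t) + (φ₂ + ε) / (e * Dm) ≤ u t := by
    intro ε hε hεs
    set c : ℝ := u 0 - (φ₂ + ε) / (e * Dm) with hc
    have hcpos : 0 < c := by
      rw [hc, sub_pos, div_lt_iff₀ hK]; linarith
    -- B s = c e^{Ks} + (φ₂+ε)/K, B' = K c e^{Ks} = K B - (φ₂ + ε)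
    have hBd : ∀ s, HasDerivAt (fun s => -(c * Real.exp (e * Dm * s) + (φ₂ + ε) / (e * Dm)))
        (-(e * Dm * (c * Real.exp (e * Dm * s)))) s := by
      intro s
      have h := (((hasDerivAt_id s).const_mul (e * Dm)).exp.const_mul c).add_const
        ((φ₂ + ε) / (e * Dm)) |>.neg
      refine h.congr_deriv ?_
      simp; ring
    have h := image_le_of_deriv_right_lt_deriv_boundary (f := fun s => -u s) (a := 0) (b := T)
      (B := fun s => -(c * Real.exp (e * Dm * s) + (φ₂ + ε) / (e * Dm)))
      (B' := fun s => -(e * Dm * (c * Real.exp (e * Dm * s))))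
      huc.neg (fun s hs => (hu' s hs).neg) (by simp [hc]) hBd
      (fun s hs hcontact => by
        have hs' := Ico_subset_Icc_self hs
        -- contact: u s = B s > 0
        have hus : u s = c * Real.exp (e * Dm * s) + (φ₂ + ε) / (e * Dm) := by
          simp only [neg_inj] at hcontact; exact hcontact
        have hexp : 0 < Real.exp (e * Dm * s) := Real.exp_pos _
        have hupos : 0 < u s := by
          rw [hus]; have : 0 ≤ (φ₂ + ε) / (e * Dm) := div_nonneg (by linarith) hK.le
          nlinarith
        -- u' ≥ e Dm u - φ₂ = K c e^{Ks} + ε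
        have h1 : e * Dm * u s ≤ e * D s * u s := by
          have := hDD s hs'
          have := mul_le_mul_of_nonneg_right (mul_le_mul_of_nonneg_left this he.le) hupos.le
          linarith
        have hf := (abs_le.1 (hf₂ s hs')).1
        have hKu : e * Dm * u s = e * Dm * (c * Real.exp (e * Dm * s)) + (φ₂ + ε) := by
          rw [hus]; field_simp
        show -(e * D s * u s + f₂ s) < -(e * Dm * (c * Real.exp (e * Dm * s)))
        linarith)
      ht
    simp only [neg_le_neg_iff] at h
    rw [hc] at h
    linarith
  -- let ε → 0
  set A : ℝ := (u 0 - φ₂ / (e * Dm)) * Real.exp (e * Dm * t) + φ₂ / (e * Dm) with hA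
  set κ : ℝ := (Real.exp (e * Dm * t) - 1) / (e * Dm) with hκ
  have hκ0 : 0 ≤ κ := by
    rw [hκ]; refine div_nonneg ?_ hK.le
    have : 1 ≤ Real.exp (e * Dm * t) := Real.one_le_exp (mul_nonneg hK.le ht.1)
    linarith
  have hform : ∀ ε : ℝ, (u 0 - (φ₂ + ε) / (e * Dm)) * Real.exp (e * Dm * t) + (φ₂ + ε) / (e * Dm) =
      A - ε * κ := by
    intro ε; rw [hA, hκ]; field_simp; ring
  refine le_of_forall_pos_le_add fun δ hδ => ?_
  -- choose ε small
  set ε : ℝ := min ((e * Dm * u 0 - φ₂) / 2) (δ / (κ + 1)) with hε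
  have hεpos : 0 < ε := lt_min (by linarith) (div_pos hδ (by linarith))
  have hεs : ε < e * Dm * u 0 - φ₂ := lt_of_le_of_lt (min_le_left _ _) (by linarith)
  have h := hmain ε hεpos hεs
  rw [hform ε] at h
  have hεκ : ε * κ ≤ δ := by
    have h1 : ε ≤ δ / (κ + 1) := min_le_right _ _
    have h2 : ε * (κ + 1) ≤ δ := by rwa [le_div_iff₀ (by linarith)] at h1
    nlinarith
  linarith

/-- **Ignition with forcing.** In the setting of `heteroclinicTriggerChain_forcedDelayOn_growth_lower`,
if the window is long enough that the lower comparison solution reaches the level `h`,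
`(u(0) − φ₂/(eD₋))·e^{eD₋T} ≥ h` (i.e. `T ≥ log(h/(u(0) − φ₂/(eD₋)))/(eD₋)`, the `log(1/seed)/e` DELAY
LAW with forcing), then the trigger has reached `h` by time `T`: `u(T) ≥ h`. [folklore] -/
theorem heteroclinicTriggerChain_forcedDelayOn_ignition {e φ₂ Dm T h : ℝ} {D u f₂ : ℝ → ℝ}
    (he : 0 < e) (hDm : 0 < Dm) (hT : 0 ≤ T)
    (hu : ∀ t ∈ Icc 0 T, HasDerivWithinAt u (e * D t * u t + f₂ t) (Icc 0 T) t)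
    (hf₂ : ∀ t ∈ Icc 0 T, |f₂ t| ≤ φ₂) (hDD : ∀ t ∈ Icc 0 T, Dm ≤ D t)
    (hu0 : φ₂ / (e * Dm) < u 0)
    (hreach : h ≤ (u 0 - φ₂ / (e * Dm)) * Real.exp (e * Dm * T)) : h ≤ u T := by
  have hφ : 0 ≤ φ₂ := (abs_nonneg _).trans (hf₂ 0 ⟨le_rfl, hT⟩)
  have hfloor : 0 ≤ φ₂ / (e * Dm) := div_nonneg hφ (mul_pos he hDm).le
  have h1 := heteroclinicTriggerChain_forcedDelayOn_growth_lower he hDm hu hf₂ hDD hu0 T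
    (right_mem_Icc.2 hT)
  linarith

end Summit.NavierStokesRegularity.NavierStokesRegularity.Theorems

end
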